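import Summits.QuantumFields.BalabanUV.T4Continuum.Support.TermwiseLocalThm1Coarse
import Summits.QuantumFields.BalabanUV.T4Continuum.Support.TermwiseResidualWitnessLedger

/-!
# TermwiseLocalRegCoarseW — INTERFACE REQUEST NE7→NE7b «HR TOWER» B1 (road t4-ne7-p1 g110, [NE7P1-G110-INBOX-4], ROAD-G110 §5 option A):
# the term-wise `U(N)` ledger theorem IN THE CONSUMED BACKGROUND SHAPE — the statement of
# `TermwiseLocalThm1LedgerW.goodClause_summable_UN_levels_of_thm1At_residualW` with its (D)-segment (the typed Theorem 1
# `B11Thm1.Thm1At Cst (fam …)` BY NAME, realisations, minimal-orbit data, per-level coverings) REPLACED by the per-window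
# `HolderReg … β₀ …` binders `hA9W hB9W` on concrete backgrounds `VA VB` with constants `a₀ a₁ a₂`
# (= the (D) block of `TermwiseLocalReg.goodClause_summable_UN_levels_of_holderReg`, VA-form)

Cell `pub-balaban`, rung (B)+1 sub-cell t4, lineage `b2b-balaban-t4-ne7b-p1` (row NE7b OWNER + CRUX PROVER), generation 156 —
junction service for row NE7 (owner lineage `b2b-balaban-t4-ne7-p1`).  WHY (the road's [NE7P1-G110-INBOX-3] + C-B8-18):
the typed (9) Hölder clause at `β = 1` inside `Thm1At` is stronger than print and presumably uninhabitable by honestly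
realised minimisers once all levels are in the family; the HR tower asks the consumer only for `HolderReg` at a
displayed `β₀` (instantiate `β₀ < 1`); the `Thm1At` tower of record stays as a corollary through the adapter
`TermwiseHolder.holderReg_window_family_of_thm1At`.
WHAT IS PROVED ([folklore]; 0 def, 0 sorry; ONE CALL of each companion, exactly as `…of_thm1At_coarse` and
`…of_thm1At_residualW` do).  **`goodClause_summable_UN_levels_of_holderReg_coarse_residualW`**: the holderReg END with
(i) the fine-label triple DERIVED (`lvlBf K t τ v x := lvlB K t τ v (x.1, ⌊x.2∕L⌋)`; `hB9F`, `hwinBf` from `hB9W`,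
`hwinB` by `block_mem_pbox` ∕ `inBox_block`) and (ii) the residual kind's binders `hwpos hRw hRRw hWw hsw` PRODUCED by
`TermwiseResidualWitness.residualWitness_of_format` ∕ `summable_witnessRadius` from the format (W-fmt) and the inputs
(W-sc)(W-loc)(W-size)(W-rate-t)(W-mult-F)(W-win)(W-rate-0)(W-mult).  Conclusion `GoodClause l₀ vol T A B Bad δ⁗ ∧
Summable δ⁗` with `δ⁗` = the LedgerW END's under `Cst.B₃·Mc ↦ a₀, a₁`, `Cst.B₄·Mc ↦ a₂` (read off `…of_holderReg`),
residual share `rw′ K`, `sw′ K + max(CF,1)·(Ew+CrW)·Σ min(aⁿ, θ′^jΛⁿ) + 2·CrW·Cw·windowSum θ′ Λ (jlogOf Cl K) K`.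
HONEST FRAMING (page 1): FIXED FINITE T⁴, rung (B)+1, CONDITIONAL on BetaPertH and the nine spine estimates (0/9
proved); NOT infinite volume, NOT a mass gap, NOT the Clay problem; NE7 NOT PRINTED, NOT proved here: every estimate is
a HYPOTHESIS BINDER named in the statement; row NE7b (`T4WeightBudget.RelWeightBound`) NOT PRINTED ∕ NOT PROVED.
[folklore] bookkeeping; no definitions, nothing printed asserted.
-/

noncomputable section

open Finset MeasureTheory _root_.Filter _root_.Topology
open scoped BigOperators Matrix.Norms.L2Operator

namespace Summit.QuantumFields.BalabanUV.T4Continuum.TermwiseLocal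

open Literature.MathematicalPhysics.QuantumFieldTheory.Balaban1983to89
open T4OutputRate T4RecentScale T4GoodClassBudget T4CauchySum T4Crossover T4TowerRateComposition T4TowerRateDischarge
open T4BoundaryCarrier (BFunctional atFl NE9Fl LipBackgroundFl NE5B)
open T4TermwiseBudget T4TermwiseDeviation T4TermwiseCurrency T4TermwiseBoundary T4TermwiseResidual T4TermwiseAction
open T4TermwiseClassical T4TermwiseQuartic
open T4TermwiseInstantiate (cBCH cBCH_nonneg cSZ cSZ_nonneg)
open T4TermwiseOscillation (cOSC)
open B7Prop1Explicit B7Prop2Explicit B7Prop1Local T4TermwiseBCH T4TermwiseTorus T4TermwiseUN T4TermwiseChainUN B11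
open TermwiseBackground (LocReg cReg cOscReg cReg_nonneg)
open TermwiseHolder (HolderReg Realises holderReg_window_family_of_thm1At)

/-! ## The END with leaf S.5 produced -/

section Ledger
variable {n : Type*} [Fintype n] [DecidableEq n] [Nonempty n]
variable {C : T4BoundaryCarrier.Carriers} {ι : Type} [MeasurableSpace ι] {σ : Type*} [DecidableEq σ] {l₀ vol : ℝ}
  {T : ℕ → Finset σ} {Bad : ℕ → ℝ → Finset σ} {A B : ℕ → ℝ → σ → ℝ} {μ : ℕ → ℝ → σ → Measure ι}
  {fac bfac rfac : ℕ → ℝ → σ → Finset C.Dom} {Adm : Set ι} {EA : Functional C.toCarriers C.BgA}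
  {EB : Functional C.toCarriers C.BgB} {BA : BFunctional C C.BgA} {BB : BFunctional C C.BgB}
  {RA : Functional C.toCarriers C.BgA} {RB : Functional C.toCarriers C.BgB}
  {κ θ' Cr EB₀ CrR R₁ b β' w₀ : ℝ} {κ₀ : ℕ} {gA gB : ℕ → ℕ → ℝ} {gfA gfB : ℕ → ℝ} {gsA gsB : ℕ → ℕ → ℝ}
  {uA : ℕ → ι → C.BgA} {uB : ℕ → ι → C.BgB} {oneA : C.BgA} {oneB : C.BgB}
  {pend : ℕ → ℝ → σ → ι → C.Fl} {nA nB aA aB wA wB γA γB : ℕ → ℝ → σ → ι → ℝ} {qA qB : ℕ → ℝ}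
  {κ₁ S : ℕ → ℝ → σ → ℕ → ℝ} {cW' RW' : ℕ → ℝ → σ → ℝ} {rw' sw' rγ zA zB c₀' : ℕ → ℝ} {Cw E a Λ Cl CF Ew CrW : ℝ}

/-- **THE TERM-WISE LEDGER THEOREM IN THE CONSUMED BACKGROUND SHAPE (HR), coarse labels, leaf S.5 produced**
(statement in the file header): `TermwiseLocalReg.goodClause_summable_UN_levels_of_holderReg` with the fine-label
triple derived and the residual kind's binders produced.  No print is quoted as a fact; NOT NE7, NOT Clay. [folklore] -/
theorem goodClause_summable_UN_levels_of_holderReg_coarse_residualW {Y YA : Type*} {Sfib : ℕ → ℝ → σ → ι → Set Y}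
    {SfibA : ℕ → ℝ → σ → ι → Set YA} {g : ℕ → ℝ → σ → ι → YA → ℝ} {f₁ : ℕ → ℝ → σ → ι → Y → ℝ}
    {Q : ℕ → ℝ → σ → ι → Y → YA} {yA yB : ℕ → ℝ → σ → ι → Y} {xA : ℕ → ℝ → σ → ι → YA}
    (M L : ℕ) (hMtwo : 2 ≤ M) (hLtwo : 2 ≤ L) (planes : Finset (Fin 4 × Fin 4))
    (hplanes : ∀ P ∈ planes, P.1 ≠ P.2)
    (VA VB : ℕ → ℝ → σ → ι → (B7Prop1Explicit.Site 4 → Fin 4 → (Matrix n n ℂ)ˣ))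
    (lvlA lvlB : ℕ → ℝ → σ → ι → (Fin 4 × Fin 4) × B7Prop1Explicit.Site 4 → ℕ)
    {a₀ a₁ a₂ ε₁ β₀ : ℝ}
    (hUR : ∀ K, URateUpTo K EA EB (gA K) (gB K) (uA K) (uB K) Adm Cr θ' κ) (hCr : 0 ≤ Cr)
    (hθ'0 : 0 < θ') (hθ'1 : θ' < 1) (hθ'Λ : θ' ≤ Λ) (hΛ1 : 1 ≤ Λ) (hCl : 0 ≤ Cl)
    (hURB : ∀ b ∈ C.admFl, ∀ K, URateUpTo K (atFl BA b) (atFl BB b) (gA K) (gB K) (uA K) (uB K) Adm EB₀ θ' κ)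
    (hEB₀ : 0 ≤ EB₀)
    (hURR : ∀ K, URateUpTo K RA RB (gA K) (gB K) (uA K) (uB K) Adm CrR θ' κ) (hCrR : 0 ≤ CrR)
    (hfmtA : ∀ K t τ, A K t τ = ∫ v, (∏ X ∈ fac K t τ,
      Real.exp (EA (gA K) (uA K v) X - EA (gA K) oneA X)) *
        ((∏ X ∈ bfac K t τ, Real.exp (BA (gA K) (uA K v) (pend K t τ v) X)) * nA K t τ v * qA K *
          ((∏ X ∈ rfac K t τ, Real.exp (RA (gA K) (uA K v) X - RA (gA K) oneA X)) * (Real.exp (-aA K t τ v) * wA K t τ v)))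
          ∂(μ K t τ))
    (hfmtB : ∀ K t τ, B K t τ = ∫ v, (∏ X ∈ fac K t τ,
      Real.exp (EB (gB K) (uB K v) X - EB (gB K) oneB X)) *
        ((∏ X ∈ bfac K t τ, Real.exp (BB (gB K) (uB K v) (pend K t τ v) X)) * nB K t τ v * qB K *
          ((∏ X ∈ rfac K t τ, Real.exp (RB (gB K) (uB K v) X - RB (gB K) oneB X)) * (Real.exp (-aB K t τ v) * wB K t τ v)))
          ∂(μ K t τ))
    (hint : ∀ K t, |t| ≤ l₀ → ∀ τ ∈ T K \ Bad K t,
      Integrable (fun v => (∏ X ∈ fac K t τ, Real.exp (EA (gA K) (uA K v) X - EA (gA K) oneA X)) *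
        ((∏ X ∈ bfac K t τ, Real.exp (BA (gA K) (uA K v) (pend K t τ v) X)) * nA K t τ v * qA K *
          ((∏ X ∈ rfac K t τ, Real.exp (RA (gA K) (uA K v) X - RA (gA K) oneA X)) * (Real.exp (-aA K t τ v) * wA K t τ v))))
          (μ K t τ) ∧
      Integrable (fun v => (∏ X ∈ fac K t τ, Real.exp (EB (gB K) (uB K v) X - EB (gB K) oneB X)) *
        ((∏ X ∈ bfac K t τ, Real.exp (BB (gB K) (uB K v) (pend K t τ v) X)) * nB K t τ v * qB K *
          ((∏ X ∈ rfac K t τ, Real.exp (RB (gB K) (uB K v) X - RB (gB K) oneB X)) * (Real.exp (-aB K t τ v) * wB K t τ v))))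
          (μ K t τ))
    (hsc : ∀ K t, |t| ≤ l₀ → ∀ τ ∈ T K \ Bad K t, ∀ X ∈ fac K t τ, C.scale X ≤ K)
    (hoff : ∀ K t, |t| ≤ l₀ → ∀ τ ∈ T K \ Bad K t, ∀ v, v ∉ Adm →
      (∏ X ∈ fac K t τ, Real.exp (EA (gA K) (uA K v) X - EA (gA K) oneA X)) *
        ((∏ X ∈ bfac K t τ, Real.exp (BA (gA K) (uA K v) (pend K t τ v) X)) * nA K t τ v * qA K *
          ((∏ X ∈ rfac K t τ, Real.exp (RA (gA K) (uA K v) X - RA (gA K) oneA X)) * (Real.exp (-aA K t τ v) * wA K t τ v)))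
          = 0 ∧
      (∏ X ∈ fac K t τ, Real.exp (EB (gB K) (uB K v) X - EB (gB K) oneB X)) *
        ((∏ X ∈ bfac K t τ, Real.exp (BB (gB K) (uB K v) (pend K t τ v) X)) * nB K t τ v * qB K *
          ((∏ X ∈ rfac K t τ, Real.exp (RB (gB K) (uB K v) X - RB (gB K) oneB X)) * (Real.exp (-aB K t τ v) * wB K t τ v)))
          = 0)
    (hS : ∀ K t, |t| ≤ l₀ → ∀ τ ∈ T K \ Bad K t, ∀ v ∈ Adm, ∀ j ≤ K,
      |(∑ X ∈ fac K t τ with C.scale X = j,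
          (Real.log (Real.exp (EB (gB K) (uB K v) X - EB (gB K) oneB X))
            - Real.log (Real.exp (EA (gA K) (uA K v) X - EA (gA K) oneA X)))) - κ₁ K t τ j| ≤ S K t τ j)
    (hM : ∀ K t, |t| ≤ l₀ → ∀ τ ∈ T K \ Bad K t,
      Multiplicity (fac K t τ) C.scale (fun X => Real.exp (-(κ * C.d X))) Cw vol Λ K)
    (hwit : ∀ K, ∃ v₁ ∈ Adm, uA K v₁ = oneA ∧ uB K v₁ = oneB)
    (hvol : 0 ≤ vol) (hE : 0 ≤ E) (ha0 : 0 < a) (ha1 : a < 1)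
    (hSle : ∀ K t, |t| ≤ l₀ → ∀ τ ∈ T K \ Bad K t, ∀ j ≤ K, S K t τ j ≤ vol * (E * a ^ (K - j)))
    (hpend : ∀ K t, |t| ≤ l₀ → ∀ τ ∈ T K \ Bad K t, ∀ v ∈ Adm, pend K t τ v ∈ C.admFl)
    (hBwin : ∀ K t, |t| ≤ l₀ → ∀ τ ∈ T K \ Bad K t, RecentOnly (bfac K t τ) C.scale (jlogOf Cl K) K)
    (hMB : ∀ K t, |t| ≤ l₀ → ∀ τ ∈ T K \ Bad K t,
      Multiplicity (bfac K t τ) C.scale (fun X => Real.exp (-(κ * C.d X))) Cw vol Λ K)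
    (hnpos : ∀ K t, |t| ≤ l₀ → ∀ τ ∈ T K \ Bad K t, ∀ v ∈ Adm, 0 < nA K t τ v ∧ 0 < nB K t τ v)
    (hzA : ∀ K t, |t| ≤ l₀ → ∀ τ ∈ T K \ Bad K t, ∀ v ∈ Adm, |Real.log (nA K t τ v)| ≤ vol * zA K)
    (hzB : ∀ K t, |t| ≤ l₀ → ∀ τ ∈ T K \ Bad K t, ∀ v ∈ Adm, |Real.log (nB K t τ v)| ≤ vol * zB K)
    (hzAs : Summable zA) (hzBs : Summable zB)
    (hq : ∀ K, 0 < qA K ∧ 0 < qB K)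
    -- the 𝐑-kind: scales, multiplicity, one-run slice sizes, the flow window of both coupling tables
    (hrsc : ∀ K t, |t| ≤ l₀ → ∀ τ ∈ T K \ Bad K t, ∀ X ∈ rfac K t τ, C.scale X ≤ K)
    (hMR : ∀ K t, |t| ≤ l₀ → ∀ τ ∈ T K \ Bad K t,
      Multiplicity (rfac K t τ) C.scale (fun X => Real.exp (-(κ * C.d X))) Cw vol Λ K)
    (hRSA : ∀ K t, |t| ≤ l₀ → ∀ τ ∈ T K \ Bad K t, ∀ v ∈ Adm, ∀ j ≤ K,
      |∑ X ∈ rfac K t τ with C.scale X = j, (RA (gA K) (uA K v) X - RA (gA K) oneA X)| ≤ vol * (R₁ * gsA K j ^ κ₀))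
    (hRSB : ∀ K t, |t| ≤ l₀ → ∀ τ ∈ T K \ Bad K t, ∀ v ∈ Adm, ∀ j ≤ K,
      |∑ X ∈ rfac K t τ with C.scale X = j, (RB (gB K) (uB K v) X - RB (gB K) oneB X)| ≤ vol * (R₁ * gsB K j ^ κ₀))
    (hb : 0 < b) (h031A : ∀ K, Step.Discrete031 b β' K (gfA K) (gsA K))
    (h031B : ∀ K, Step.Discrete031 b β' K (gfB K) (gsB K)) (hgsA : ∀ K k, k ≤ K → 0 ≤ gsA K k)
    (hgsB : ∀ K k, k ≤ K → 0 ≤ gsB K k) (hR₁ : 0 ≤ R₁) (hκ₀ : 4 < κ₀)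
    -- the ACTION kind from ONE CLASSICAL STEP: (min-A) (Q) (lift) (min-B) (act) (U) (L) (γ)
    (hminA : ∀ K t, |t| ≤ l₀ → ∀ τ ∈ T K \ Bad K t, ∀ v ∈ Adm, IsMinOn (g K t τ v) (SfibA K t τ v) (xA K t τ v))
    (hQ : ∀ K t, |t| ≤ l₀ → ∀ τ ∈ T K \ Bad K t, ∀ v ∈ Adm, Set.MapsTo (Q K t τ v) (Sfib K t τ v) (SfibA K t τ v))
    (hlift : ∀ K t, |t| ≤ l₀ → ∀ τ ∈ T K \ Bad K t, ∀ v ∈ Adm,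
      yA K t τ v ∈ Sfib K t τ v ∧ Q K t τ v (yA K t τ v) = xA K t τ v)
    (hminB : ∀ K t, |t| ≤ l₀ → ∀ τ ∈ T K \ Bad K t, ∀ v ∈ Adm,
      yB K t τ v ∈ Sfib K t τ v ∧ IsMinOn (f₁ K t τ v) (Sfib K t τ v) (yB K t τ v))
    (hact : ∀ K t, |t| ≤ l₀ → ∀ τ ∈ T K \ Bad K t, ∀ v ∈ Adm,
      aA K t τ v = w₀ * g K t τ v (xA K t τ v) + γA K t τ v ∧
        aB K t τ v = w₀ * f₁ K t τ v (yB K t τ v) + γB K t τ v)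
    (hw₀ : 0 ≤ w₀)
    -- (U)(L) PRODUCED for G = U(N) Wilson terms from the PRINTED-CURRENCY regularity binder PER WINDOW AT THE WINDOW's
    -- LEVEL (`HolderReg` = B11 Thm 1 (9) read with B9 (3.40) at U₀ = 1, spacing (L^{lvl y})⁻¹, Hölder exponent β₀):
    -- unitarity + periodicity `hAU hBU`, `hA9W hB9W` on the window boxes (run B's fine
    -- plaquette binders DERIVED inside), the window clauses `hwinA hwinB`, the constants' signs, `ε₁ ≤ 1`, the smallness, `0 < β₀ ≤ 1`
    (hAU : ∀ K t, |t| ≤ l₀ → ∀ τ ∈ T K \ Bad K t, ∀ v ∈ Adm,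
      (∀ x κ, VA K t τ v x κ ∈ unitaryUnits (Matrix n n ℂ)) ∧ IsPeriodic (M * L ^ K * L) (VA K t τ v))
    (hBU : ∀ K t, |t| ≤ l₀ → ∀ τ ∈ T K \ Bad K t, ∀ v ∈ Adm,
      (∀ x κ, VB K t τ v x κ ∈ unitaryUnits (Matrix n n ℂ)) ∧ IsPeriodic (M * L ^ K * L) (VB K t τ v))
    (hA9W : ∀ K t, |t| ≤ l₀ → ∀ τ ∈ T K \ Bad K t, ∀ v ∈ Adm, ∀ y ∈ pbox planes (M * L ^ K),
      ∀ x : B7Prop1Explicit.Site 4, InBox ((L : ℤ) • y.2) (deltaHi L ((L : ℤ) • y.2) y.1.1 y.1.2) x →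
        HolderReg (VA K t τ v) x 6 (((L : ℝ) ^ lvlA K t τ v y)⁻¹) (a₀ * ε₁) (a₁ * ε₁) β₀ (a₂ * ε₁))
    (hB9W : ∀ K t, |t| ≤ l₀ → ∀ τ ∈ T K \ Bad K t, ∀ v ∈ Adm, ∀ y ∈ pbox planes (M * L ^ K),
      ∀ x : B7Prop1Explicit.Site 4, InBox ((L : ℤ) • y.2) (deltaHi L ((L : ℤ) • y.2) y.1.1 y.1.2) x →
        HolderReg (VB K t τ v) x 6 (((L : ℝ) ^ lvlB K t τ v y)⁻¹) (a₀ * ε₁) (a₁ * ε₁) β₀ (a₂ * ε₁))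
    (hwinA : ∀ K t, |t| ≤ l₀ → ∀ τ ∈ T K \ Bad K t, ∀ v ∈ Adm,
      RecentOnly (pbox planes (M * L ^ K)) (lvlA K t τ v) (jlogOf Cl K) K)
    (hwinB : ∀ K t, |t| ≤ l₀ → ∀ τ ∈ T K \ Bad K t, ∀ v ∈ Adm,
      RecentOnly (pbox planes (M * L ^ K)) (lvlB K t τ v) (jlogOf Cl K) K)
    (ha₀ : 0 ≤ a₀) (ha₁ : 0 ≤ a₁) (ha₂ : 0 ≤ a₂) (hε₁ : 0 ≤ ε₁) (hε₁1 : ε₁ ≤ 1)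
    (hsmall : 20480 * (L : ℝ) ^ 2 * (cReg a₀ a₁ * ε₁) ≤ 1) (hβ₀ : 0 < β₀) (hβ₀1 : β₀ ≤ 1)
    (hreprU : ∀ K t, |t| ≤ l₀ → ∀ τ ∈ T K \ Bad K t, ∀ v ∈ Adm,
      f₁ K t τ v (yA K t τ v) = ∑ x ∈ pbox planes (M * L ^ K * L), eN (phiU (VA K t τ v) x) ∧
        g K t τ v (xA K t τ v) = ∑ y ∈ pbox planes (M * L ^ K), eN (psiU L (VA K t τ v) y))
    (hreprL : ∀ K t, |t| ≤ l₀ → ∀ τ ∈ T K \ Bad K t, ∀ v ∈ Adm,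
      f₁ K t τ v (yB K t τ v) = ∑ x ∈ pbox planes (M * L ^ K * L), eN (phiU (VB K t τ v) x) ∧
        g K t τ v (Q K t τ v (yB K t τ v)) = ∑ y ∈ pbox planes (M * L ^ K), eN (psiU L (VB K t τ v) y))
    (hMvol : ((M : ℝ)) ^ 4 ≤ vol)
    (hγ : ∀ K t, |t| ≤ l₀ → ∀ τ ∈ T K \ Bad K t, ∀ v ∈ Adm, |γB K t τ v - γA K t τ v| ≤ vol * rγ K)
    (hrγ : Summable rγ)
    -- leaf S.5 PRODUCED (`TermwiseResidualWitness(Ledger)`): (W-fmt) the residual-proper factor's FORMAT with a residue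
    -- `w′` keeping the END's own binder shapes; (W-sc)(W-loc)(W-size)(W-rate-t)(W-mult-F)(W-win)(W-rate-0)(W-mult)
    (wA' wB' : ℕ → ℝ → σ → ι → ℝ) (wfac nf : ℕ → ℝ → σ → Finset C.Dom) (wfac₀ : ℕ → Finset C.Dom)
    (vcA vcB : ℕ → ℝ → C.Dom → ℝ) (hEw : 0 ≤ Ew) (hCrW : 0 ≤ CrW)
    (hwA : ∀ K t, |t| ≤ l₀ → ∀ τ ∈ T K \ Bad K t, ∀ v ∈ Adm,
      wA K t τ v = wA' K t τ v * Real.exp (∑ X ∈ wfac K t τ, vcA K t X))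
    (hwB : ∀ K t, |t| ≤ l₀ → ∀ τ ∈ T K \ Bad K t, ∀ v ∈ Adm,
      wB K t τ v = wB' K t τ v * Real.exp (∑ X ∈ wfac K t τ, vcB K t X))
    (hw'pos : ∀ K t, |t| ≤ l₀ → ∀ τ ∈ T K \ Bad K t, ∀ v ∈ Adm, 0 < wA' K t τ v ∧ 0 < wB' K t τ v)
    (hRw' : ∀ K t, |t| ≤ l₀ → ∀ τ ∈ T K \ Bad K t, ∀ v ∈ Adm,
      |Real.log (wB' K t τ v) - Real.log (wA' K t τ v) - cW' K t τ| ≤ RW' K t τ)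
    (hRRw' : ∀ K t, |t| ≤ l₀ → ∀ τ ∈ T K \ Bad K t, RW' K t τ ≤ vol * rw' K) (hrw' : Summable rw')
    (hWw' : ∀ K t, |t| ≤ l₀ → ∀ τ ∈ T K \ Bad K t, ∀ v ∈ Adm, uA K v = oneA → uB K v = oneB →
      |Real.log (wB' K t τ v) - Real.log (wA' K t τ v) - c₀' K| ≤ vol * sw' K)
    (hsw' : Summable sw')
    (hWsc : ∀ K t, |t| ≤ l₀ → ∀ τ ∈ T K \ Bad K t, ∀ X ∈ wfac K t τ, C.scale X ≤ K)
    (hWsc₀ : ∀ K, ∀ X ∈ wfac₀ K, C.scale X ≤ K)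
    (hWloc : ∀ K t, |t| ≤ l₀ → ∀ τ ∈ T K \ Bad K t, ∀ X ∈ wfac K t τ, X ∉ nf K t τ →
      vcA K t X = vcA K 0 X ∧ vcB K t X = vcB K 0 X)
    (hWsize : ∀ K t, |t| ≤ l₀ → ∀ τ ∈ T K \ Bad K t, ∀ j ≤ K,
      ∑ X ∈ wfac K t τ with C.scale X = j, (|vcA K t X - vcA K 0 X| + |vcB K t X - vcB K 0 X|)
        ≤ vol * (Ew * a ^ (K - j)))
    (hWratet : ∀ K t, |t| ≤ l₀ → ∀ τ ∈ T K \ Bad K t, ∀ X ∈ wfac K t τ, X ∈ nf K t τ →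
      |(vcB K t X - vcB K 0 X) - (vcA K t X - vcA K 0 X)| ≤ CrW * θ' ^ C.scale X * Real.exp (-(κ * C.d X)))
    (hWMF : ∀ K t, |t| ≤ l₀ → ∀ τ ∈ T K \ Bad K t,
      Multiplicity (nf K t τ) C.scale (fun X => Real.exp (-(κ * C.d X))) CF vol Λ K)
    (hWwin : ∀ K t, |t| ≤ l₀ → ∀ τ ∈ T K \ Bad K t, ∀ X ∈ wfac K t τ, X ∉ wfac₀ K → jlogOf Cl K ≤ C.scale X)
    (hWwin₀ : ∀ K t, |t| ≤ l₀ → ∀ τ ∈ T K \ Bad K t, ∀ X ∈ wfac₀ K, X ∉ wfac K t τ → jlogOf Cl K ≤ C.scale X)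
    (hWrate0 : ∀ K t, |t| ≤ l₀ → ∀ τ ∈ T K \ Bad K t, ∀ X ∈ wfac K t τ,
      |vcB K 0 X - vcA K 0 X| ≤ CrW * θ' ^ C.scale X * Real.exp (-(κ * C.d X)))
    (hWrate0' : ∀ K, ∀ X ∈ wfac₀ K, |vcB K 0 X - vcA K 0 X| ≤ CrW * θ' ^ C.scale X * Real.exp (-(κ * C.d X)))
    (hWM : ∀ K t, |t| ≤ l₀ → ∀ τ ∈ T K \ Bad K t,
      Multiplicity (wfac K t τ) C.scale (fun X => Real.exp (-(κ * C.d X))) Cw vol Λ K)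
    (hWM₀ : ∀ K, Multiplicity (wfac₀ K) C.scale (fun X => Real.exp (-(κ * C.d X))) Cw vol Λ K) :
    GoodClause l₀ vol T A B Bad
        (fun K => (max Cw 1 * ((E + Cr) * ∑ x ∈ antidiagonal K, min (a ^ x.2) (θ' ^ x.1 * Λ ^ x.2))
            + (EB₀ * Cw * windowSum θ' Λ (jlogOf Cl K) K + (zA K + zB K)
              + (max (2 * Cw) 1 * ((∑ p ∈ antidiagonal K, min (R₁ * gsA K p.1 ^ κ₀) (CrR * θ' ^ p.1 * Λ ^ p.2))
                  + ∑ p ∈ antidiagonal K, min (R₁ * gsB K p.1 ^ κ₀) (CrR * θ' ^ p.1 * Λ ^ p.2))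
                + (w₀ * ((planes.card : ℝ) * (cOSC L (cOscReg L a₀ a₁ a₂) ^ 2 * ε₁ ^ 2 / 4
                        * windowSum (((L : ℝ) ^ (-β₀)) ^ 2) ((L : ℝ) ^ 4) (jlogOf Cl K) K
                      + (cSZ L (cReg a₀ a₁) * cBCH L (cReg a₀ a₁) * ε₁ ^ 3
                          + (Fintype.card n : ℝ) / 24 * (cSZ L (cReg a₀ a₁) * ε₁
                            + cBCH L (cReg a₀ a₁) * ε₁ ^ 2) ^ 4)
                        * windowSum (((L : ℝ) ^ 2)⁻¹) ((L : ℝ) ^ 4) (jlogOf Cl K) K)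
                    + (planes.card : ℝ)
                      * (cSZ L (cReg a₀ a₁) * cBCH L (cReg a₀ a₁) * ε₁ ^ 3
                        + cBCH L (cReg a₀ a₁) ^ 2 * ε₁ ^ 4 / 2
                        + (Fintype.card n : ℝ) / 24 * (cSZ L (cReg a₀ a₁) ^ 4 * ε₁ ^ 4))
                      * windowSum (((L : ℝ) ^ 2)⁻¹) ((L : ℝ) ^ 4) (jlogOf Cl K) K)
                  + rγ K + rw' K))))
          + (max Cw 1 * ((E + Cr) * ∑ x ∈ antidiagonal K, min (a ^ x.2) (θ' ^ x.1 * Λ ^ x.2)) 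
            + (rw' K + (sw' K + (max CF 1 * ((Ew + CrW) * ∑ x ∈ antidiagonal K, min (a ^ x.2) (θ' ^ x.1 * Λ ^ x.2))
              + 2 * (CrW * Cw * windowSum θ' Λ (jlogOf Cl K) K)))))) ∧
      Summable (fun K => (max Cw 1 * ((E + Cr) * ∑ x ∈ antidiagonal K, min (a ^ x.2) (θ' ^ x.1 * Λ ^ x.2))
            + (EB₀ * Cw * windowSum θ' Λ (jlogOf Cl K) K + (zA K + zB K)
              + (max (2 * Cw) 1 * ((∑ p ∈ antidiagonal K, min (R₁ * gsA K p.1 ^ κ₀) (CrR * θ' ^ p.1 * Λ ^ p.2))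
                  + ∑ p ∈ antidiagonal K, min (R₁ * gsB K p.1 ^ κ₀) (CrR * θ' ^ p.1 * Λ ^ p.2))
                + (w₀ * ((planes.card : ℝ) * (cOSC L (cOscReg L a₀ a₁ a₂) ^ 2 * ε₁ ^ 2 / 4
                        * windowSum (((L : ℝ) ^ (-β₀)) ^ 2) ((L : ℝ) ^ 4) (jlogOf Cl K) K
                      + (cSZ L (cReg a₀ a₁) * cBCH L (cReg a₀ a₁) * ε₁ ^ 3
                          + (Fintype.card n : ℝ) / 24 * (cSZ L (cReg a₀ a₁) * ε₁
                            + cBCH L (cReg a₀ a₁) * ε₁ ^ 2) ^ 4)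
                        * windowSum (((L : ℝ) ^ 2)⁻¹) ((L : ℝ) ^ 4) (jlogOf Cl K) K)
                    + (planes.card : ℝ)
                      * (cSZ L (cReg a₀ a₁) * cBCH L (cReg a₀ a₁) * ε₁ ^ 3
                        + cBCH L (cReg a₀ a₁) ^ 2 * ε₁ ^ 4 / 2
                        + (Fintype.card n : ℝ) / 24 * (cSZ L (cReg a₀ a₁) ^ 4 * ε₁ ^ 4))
                      * windowSum (((L : ℝ) ^ 2)⁻¹) ((L : ℝ) ^ 4) (jlogOf Cl K) K)
                  + rγ K + rw' K))))
          + (max Cw 1 * ((E + Cr) * ∑ x ∈ antidiagonal K, min (a ^ x.2) (θ' ^ x.1 * Λ ^ x.2)) 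
            + (rw' K + (sw' K + (max CF 1 * ((Ew + CrW) * ∑ x ∈ antidiagonal K, min (a ^ x.2) (θ' ^ x.1 * Λ ^ x.2))
              + 2 * (CrW * Cw * windowSum θ' Λ (jlogOf Cl K) K)))))) := by
  obtain ⟨hwpos, hRw, hRRw, hWw⟩ := TermwiseResidualWitness.residualWitness_of_format (l₀ := l₀) (vol := vol)
    (T := T) (Bad := Bad) (Adm := Adm) uA uB oneA oneB wA wB wA' wB' wfac nf wfac₀ vcA vcB C.scale
    (fun X => Real.exp (-(κ * C.d X))) (cW' := cW') (RW' := RW') (rw' := rw') (sw' := sw') (c₀' := c₀') (CF := CF)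
    (Cw := Cw) (Ew := Ew) (a := a) (θ' := θ') (Λ := Λ) (CrW := CrW) (Cl := Cl) hvol hEw ha0.le hθ'0.le
    (zero_le_one.trans hΛ1) hCrW hwA hwB hw'pos hRw' hRRw' hWw' hWsc hWsc₀ hWloc hWsize hWratet
    (fun X => (Real.exp_pos _).le) hWMF hWwin hWwin₀ hWrate0 hWrate0' hWM hWM₀
  have hsw := TermwiseResidualWitness.summable_witnessRadius (CF := CF) (Cw := Cw) (Ew := Ew) (CrW := CrW) (Cl := Cl)
    hsw' ha0 ha1 hθ'0 hθ'1 hθ'Λ hΛ1 hCl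
  refine goodClause_summable_UN_levels_of_holderReg M L hMtwo hLtwo planes hplanes VA VB lvlA lvlB
    (fun K t τ v x => lvlB K t τ v (x.1, fun i => x.2 i / (L : ℤ))) hUR hCr hθ'0 hθ'1 hθ'Λ hΛ1 hCl hURB hEB₀ hURR hCrR
    hfmtA hfmtB hint hsc hoff hS hM hwit hvol hE ha0 ha1 hSle hpend hBwin hMB hnpos hzA hzB hzAs hzBs hq hrsc hMR hRSA hRSB
    hb h031A h031B hgsA hgsB hR₁ hκ₀ hminA hQ hlift hminB hact hw₀ hAU hBU hA9W hB9W ?_ hwinA hwinB ?_ ha₀ ha₁ ha₂ hε₁ hε₁1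
    hsmall hβ₀ hβ₀1 hreprU hreprL hMvol hγ hrγ hwpos hRw hRRw hrw' hWw hsw
  · -- `hB9F`: the fine plaquette's block window carries the `HolderReg` letter at the block's level
    intro K t ht τ hτ v hv x hx
    exact hB9W K t ht τ hτ v hv _ (block_mem_pbox (by omega) hx) x.2 (inBox_block (by omega) x.2 x.1.1 x.1.2)
  · -- `hwinBf`
    intro K t ht τ hτ v hv x hx
    exact hwinB K t ht τ hτ v hv _ (block_mem_pbox (by omega) hx)

end Ledger

end Summit.QuantumFields.BalabanUV.T4Continuum.TermwiseLocal
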